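import Summits.QuantumFields.YangMills.Theorems.BalabanUVNodesN15KingModelPathResolvent
import HarnessLib

/-!
# BalabanUVNodes ∕ N15 — THE KING-MODEL RUNG (PART Ϲ-h): DIRICHLET ENDS — THE ODD IMAGE SUM: the massive box resolvent with DIRICHLET boundary
# conditions is the torus resolvent of period `2n+2` MINUS its image under the reflection through the two boundary sites,
# `((2+x) − S − S⁻¹)_{Dirichlet}⁻¹(s,t) = G^{torus}_{2n+2}(s − t) − G^{torus}_{2n+2}(s + t + 2) = sinh(ω(min+1))·sinh(ω(n−max)) ∕ (sinh ω · sinh(ω(n+1)))`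
# (Track A, DAG node N15 = NE2; FAN-OUT v1.1 §N15 s3 «KING-MODEL RUNG» ∕ «torus-vs-box twin»; count-neutral; companion of PART Ϲ-g's free ends)

HONEST FRAMING.  Count-neutral (cell `pub-ymgap`, seat `pub-ymgap-dag-n15-e` g38; `--supports stmt-QuantumFields-27366 --as helper` = K3⁸).
TEMPLATE LITERATURE: C. King, Commun. Math. Phys. **102** (1986) 649–677 [King1986] §4 p.670 («multiple reflection representations … [Ba 4]»):
PART Ϲ-g treated King's own FREE boundary condition (EVEN images across the two half-bonds); THIS FILE is the companion DIRICHLET case (ODD images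
through the two boundary SITES `−1` and `n`, which are fixed by the reflection `z ↦ −2 − z` of the cycle `ℤ∕(2n+2)`): a function on the doubled cycle
that VANISHES at the two fixed sites restricts to the Dirichlet stencil on the box (§3), the odd image column `G_{2n+2}(· − t) − G_{2n+2}(· + t + 2)`
vanishes there (§4), so it inverts the Dirichlet operator, with the textbook closed form `sinh(ω(min+1))sinh(ω(n−max))∕(sinh ω sinh(ω(n+1)))` (§5)
— again with the SAME lattice mass `ω = latticeMass x`.  Montvay–Münster [MontvayMunster1994] §2.2.1 for the vocabulary.  NOT Bałaban's covariant
objects; NOT a node discharge (N15 is booked through n15-a's knit, untouched); one dimension only; nothing continuum-YM ∕ ℝ⁴ ∕ OS axioms ∕ Clay.  0 `sorry`.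

OBJECTS.  `pathOpD n x : Matrix (Fin n) (Fin n) ℝ` (Dirichlet stencil), `dblD n : Fin n → ZMod (2n+2)` (`s ↦ s`), `mirrorD n` (`s ↦ −2 − s`),
`pathGreenD n x s t := cycleGreen (2n+2) x (dblD s − dblD t) − cycleGreen (2n+2) x (dblD s − mirrorD t)`.

WHAT THIS FILE PROVES (kernel).  §1 ★ `pathOpD_mulVec_apply`.  §2 doubling letters (`dblD_add_one`, `dblD_sub_one`, `dblD_add_one_of_last` (`= n`, a fixed
site), `dblD_sub_one_of_first` (`= −1`), `mirrorD_sub_dblD`, `mirrorD_sub_mirrorD`, `dblD_sub_mirrorD`, `val_dblD_sub_mirrorD`, `dblD_ne_mirrorD`,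
`val_dblD_sub_dblD`, `dblD_injective`).  §3 ★★ **`cycleOp_mulVec_dirichletBox`** (REFLECTION PRINCIPLE, Dirichlet form).  §4 `imageColumn_apply_last`,
`imageColumn_apply_neg_one` (the odd image column vanishes at the fixed sites), ★★ `pathOpD_mulVec_pathGreenD`, ★★ `pathOpD_mul_greenMatrix`,
`isUnit_pathOpD`, ★★★ **`pathOpD_inv_apply`** (METHOD OF IMAGES, odd), `pathGreenD_symm`.  §5 ★★ **`pathGreenD_eq_cosh_sub`**, ★★ **`pathGreenD_eq_sinh_mul_sinh`**
(`= sinh(ω(min+1))·sinh(ω(n−max))∕(sinh ω·sinh(ω(n+1)))`), ★ `pathGreenD_pos`.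

HONEST SCOPE.  One dimension; `x > 0`.  N15 untouched; counts unmoved.
Locators: [King1986] §4 p.670; [MontvayMunster1994] §2.2.1 (2.74)–(2.76).
-/

noncomputable section

open scoped BigOperators
open Finset Matrix Real

namespace Summit.QuantumFields.YangMills.BalabanUVNodes.N15KingModelRung.TorusSpectral

variable (n : ℕ)

/-! ## §1 The Dirichlet stencil on the box `{0,…,n−1}` -/

section Stencil

/-- THE DIRICHLET MASSIVE SECOND-DIFFERENCE OPERATOR on the box `{0,…,n−1}`: `(s,t) ↦ (2+x)[t=s] − [t = s+1] − [t = s−1]` (the neighbours `−1` and `n`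
outside the box carry the boundary value `0`). [cite: King1986, (4.4) p.670] -/
def pathOpD (x : ℝ) : Matrix (Fin n) (Fin n) ℝ := fun s t =>
  (2 + x) * (if t = s then 1 else 0) - ((if t.val = s.val + 1 then (1 : ℝ) else 0) + (if t.val + 1 = s.val then 1 else 0))

/-- ★ THE DIRICHLET STENCIL: `(((2+x) − S − S⁻¹)_D f)(s) = (2+x)f(s) − [s+1 < n]f(s+1) − [0 < s]f(s−1)`. [cite: King1986, (4.4) p.670] -/
theorem pathOpD_mulVec_apply (x : ℝ) (f : Fin n → ℝ) (s : Fin n) :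
    (pathOpD n x *ᵥ f) s
      = (2 + x) * f s - ((if h : s.val + 1 < n then f ⟨s.val + 1, h⟩ else 0) + (if h : 0 < s.val then f ⟨s.val - 1, by omega⟩ else 0)) := by
  have hpt : ∀ t : Fin n, pathOpD n x s t * f t
      = (2 + x) * (if t = s then f t else 0) - ((if t.val = s.val + 1 then f t else 0) + (if t.val + 1 = s.val then f t else 0)) := by
    intro t; unfold pathOpD; split_ifs <;> ring
  simp only [Matrix.mulVec, dotProduct, hpt, Finset.sum_sub_distrib, Finset.sum_add_distrib, ← Finset.mul_sum, Finset.sum_ite_eq',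
    Finset.mem_univ, if_true]
  have h2 : ∑ t : Fin n, (if t.val = s.val + 1 then f t else 0) = (if h : s.val + 1 < n then f ⟨s.val + 1, h⟩ else 0) := by
    by_cases h : s.val + 1 < n
    · rw [dif_pos h]
      have : ∀ t : Fin n, (t.val = s.val + 1) ↔ (t = ⟨s.val + 1, h⟩) := fun t => by rw [Fin.ext_iff]
      simp_rw [this, Finset.sum_ite_eq', Finset.mem_univ, if_true]
    · rw [dif_neg h]
      exact Finset.sum_eq_zero fun t _ => if_neg (by omega)
  have h3 : ∑ t : Fin n, (if t.val + 1 = s.val then f t else 0) = (if h : 0 < s.val then f ⟨s.val - 1, by omega⟩ else 0) := by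
    by_cases h : 0 < s.val
    · rw [dif_pos h]
      have : ∀ t : Fin n, (t.val + 1 = s.val) ↔ (t = ⟨s.val - 1, by omega⟩) := fun t => by rw [Fin.ext_iff]; simp only; omega
      simp_rw [this, Finset.sum_ite_eq', Finset.mem_univ, if_true]
    · rw [dif_neg h]
      exact Finset.sum_eq_zero fun t _ => if_neg (by omega)
  rw [h2, h3]

end Stencil

/-! ## §2 The doubling `ℤ∕(2n+2)`: the box, the two fixed sites `−1`, `n`, and the mirror images -/

section Doubling

/-- The box point `s` in the doubled cycle `ℤ∕(2n+2)`. [folklore] -/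
def dblD (s : Fin n) : ZMod (2 * n + 2) := ((s.val : ℕ) : ZMod (2 * n + 2))

/-- The mirror image `−2 − s` of the box point `s`: the reflection through the two boundary sites `−1` and `n` (its fixed points). [cite: King1986, §4 p.670] -/
def mirrorD (s : Fin n) : ZMod (2 * n + 2) := -2 - ((s.val : ℕ) : ZMod (2 * n + 2))

/-- Interior successor. [folklore] -/
theorem dblD_add_one {s : Fin n} (h : s.val + 1 < n) : dblD n s + 1 = dblD n ⟨s.val + 1, h⟩ := by
  simp [dblD]

/-- Interior predecessor. [folklore] -/
theorem dblD_sub_one {s : Fin n} (h : 0 < s.val) : dblD n s - 1 = dblD n ⟨s.val - 1, by omega⟩ := by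
  simp only [dblD]
  rw [sub_eq_iff_eq_add]
  norm_cast
  congr 1; omega

/-- The successor of the right end is the fixed site `n`. [folklore] -/
theorem dblD_add_one_of_last {s : Fin n} (h : s.val + 1 = n) : dblD n s + 1 = ((n : ℕ) : ZMod (2 * n + 2)) := by
  simp only [dblD]; norm_cast; rw [h]

/-- The predecessor of the left end is the fixed site `−1`. [folklore] -/
theorem dblD_sub_one_of_first {s : Fin n} (h : s.val = 0) : dblD n s - 1 = (-1 : ZMod (2 * n + 2)) := by
  simp [dblD, h]

/-- `mirror s − dbl t = −(dbl s − mirror t)`. [folklore] -/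
theorem mirrorD_sub_dblD (s t : Fin n) : mirrorD n s - dblD n t = -(dblD n s - mirrorD n t) := by
  simp only [mirrorD, dblD]; ring

/-- `mirror s − mirror t = −(dbl s − dbl t)`. [folklore] -/
theorem mirrorD_sub_mirrorD (s t : Fin n) : mirrorD n s - mirrorD n t = -(dblD n s - dblD n t) := by
  simp only [mirrorD, dblD]; ring

/-- `dbl s − mirror t = s + t + 2`. [folklore] -/
theorem dblD_sub_mirrorD (s t : Fin n) : dblD n s - mirrorD n t = ((s.val + t.val + 2 : ℕ) : ZMod (2 * n + 2)) := by
  simp only [dblD, mirrorD]; push_cast; ring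

/-- `val(dbl s − mirror t) = s + t + 2` (no wrap: `≤ 2n`). [folklore] -/
theorem val_dblD_sub_mirrorD (s t : Fin n) : (dblD n s - mirrorD n t).val = s.val + t.val + 2 := by
  rw [dblD_sub_mirrorD, ZMod.val_cast_of_lt (by omega)]

/-- A box point is never the mirror image of a box point (`s + t + 2 ∈ [2, 2n]`). [folklore] -/
theorem dblD_ne_mirrorD (s t : Fin n) : dblD n s ≠ mirrorD n t := by
  intro h
  have hv := congrArg ZMod.val (sub_eq_zero.mpr h)
  rw [val_dblD_sub_mirrorD, ZMod.val_zero] at hv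
  omega

/-- `val(dbl s − dbl t) = s − t` for `t ≤ s`. [folklore] -/
theorem val_dblD_sub_dblD {s t : Fin n} (hts : t.val ≤ s.val) : (dblD n s - dblD n t).val = s.val - t.val := by
  simp only [dblD]
  rw [← Nat.cast_sub hts, ZMod.val_cast_of_lt (by omega)]

/-- `dblD` is injective. [folklore] -/
theorem dblD_injective : Function.Injective (dblD n) := by
  intro s t h
  have hs := congrArg ZMod.val h
  simp only [dblD, ZMod.val_cast_of_lt (show s.val < 2 * n + 2 by omega), ZMod.val_cast_of_lt (show t.val < 2 * n + 2 by omega)] at hs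
  exact Fin.ext hs

end Doubling

/-! ## §3 The reflection principle, Dirichlet form -/

section Reflection

/-- ★★ **THE REFLECTION PRINCIPLE (Dirichlet)**: if `F` on `ℤ∕(2n+2)` extends `f` on the box (`F(dbl s) = f(s)`) and VANISHES at the two fixed sites
`−1` and `n`, then `(((2+x) − S − S⁻¹)F)(dbl s) = (((2+x) − S − S⁻¹)_D f)(s)`. [cite: King1986, §4 p.670] -/
theorem cycleOp_mulVec_dirichletBox (x : ℝ) (F : ZMod (2 * n + 2) → ℝ) (f : Fin n → ℝ) (hF : ∀ s, F (dblD n s) = f s)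
    (hn : F ((n : ℕ) : ZMod (2 * n + 2)) = 0) (hm : F (-1) = 0) (s : Fin n) :
    (cycleOp (2 * n + 2) x *ᵥ F) (dblD n s) = (pathOpD n x *ᵥ f) s := by
  rw [cycleOp_mulVec_apply, pathOpD_mulVec_apply, hF]
  have hplus : F (dblD n s + 1) = (if h : s.val + 1 < n then f ⟨s.val + 1, h⟩ else 0) := by
    by_cases h : s.val + 1 < n
    · rw [dif_pos h, dblD_add_one n h, hF]
    · rw [dif_neg h, dblD_add_one_of_last n (by omega), hn]
  have hminus : F (dblD n s - 1) = (if h : 0 < s.val then f ⟨s.val - 1, by omega⟩ else 0) := by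
    by_cases h : 0 < s.val
    · rw [dif_pos h, dblD_sub_one n h, hF]
    · rw [dif_neg h, dblD_sub_one_of_first n (by omega), hm]
  rw [hplus, hminus]

end Reflection

/-! ## §4 The odd image sum inverts the Dirichlet operator -/

section Images

/-- THE DIRICHLET BOX GREEN's FUNCTION by odd images: `G^D(s,t) = G^{torus}_{2n+2}(s − t) − G^{torus}_{2n+2}(s − mirror t)`. [cite: King1986, §4 p.670] -/
def pathGreenD (x : ℝ) (s t : Fin n) : ℝ :=
  cycleGreen (2 * n + 2) x (dblD n s - dblD n t) - cycleGreen (2 * n + 2) x (dblD n s - mirrorD n t)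

/-- The odd image column vanishes at the fixed site `n`: `G_{2n+2}(n − t) = G_{2n+2}(n + 2 + t)` (`(n−t) + (n+2+t) = 2n+2`). [folklore] -/
theorem imageColumn_apply_last (x : ℝ) (t : Fin n) :
    cycleGreen (2 * n + 2) x (((n : ℕ) : ZMod (2 * n + 2)) - dblD n t) - cycleGreen (2 * n + 2) x (((n : ℕ) : ZMod (2 * n + 2)) - mirrorD n t) = 0 := by
  rw [sub_eq_zero]
  have h : ((n : ℕ) : ZMod (2 * n + 2)) - mirrorD n t = -((((n : ℕ) : ZMod (2 * n + 2)) - dblD n t)) := by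
    simp only [mirrorD, dblD]
    have h0 : ((2 * n + 2 : ℕ) : ZMod (2 * n + 2)) = 0 := ZMod.natCast_self _
    have : (2 : ZMod (2 * n + 2)) * (n : ℕ) + 2 = 0 := by rw [← h0]; push_cast; ring
    linear_combination this
  rw [h, cycleGreen_neg]

/-- The odd image column vanishes at the fixed site `−1`: `G_{2n+2}(−1 − t) = G_{2n+2}(1 + t)`. [folklore] -/
theorem imageColumn_apply_neg_one (x : ℝ) (t : Fin n) :
    cycleGreen (2 * n + 2) x ((-1 : ZMod (2 * n + 2)) - dblD n t) - cycleGreen (2 * n + 2) x ((-1 : ZMod (2 * n + 2)) - mirrorD n t) = 0 := by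
  rw [sub_eq_zero]
  have h : (-1 : ZMod (2 * n + 2)) - mirrorD n t = -((-1 : ZMod (2 * n + 2)) - dblD n t) := by
    simp only [mirrorD, dblD]; ring
  rw [h, cycleGreen_neg]

/-- ★★ The odd image sum inverts the Dirichlet operator, column by column (`x > 0`). [cite: King1986, §4 p.670] -/
theorem pathOpD_mulVec_pathGreenD {x : ℝ} (hx : 0 < x) (t : Fin n) :
    pathOpD n x *ᵥ (fun s => pathGreenD n x s t) = Pi.single t (1 : ℝ) := by
  funext s
  let F : ZMod (2 * n + 2) → ℝ := fun z => cycleGreen (2 * n + 2) x (z - dblD n t) - cycleGreen (2 * n + 2) x (z - mirrorD n t)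
  have hF : ∀ s', F (dblD n s') = pathGreenD n x s' t := fun s' => rfl
  rw [← cycleOp_mulVec_dirichletBox n x F (fun s' => pathGreenD n x s' t) hF (imageColumn_apply_last n x t)
    (imageColumn_apply_neg_one n x t) s]
  have hsplit : F = (fun z => cycleGreen (2 * n + 2) x (z - dblD n t)) - (fun z => cycleGreen (2 * n + 2) x (z - mirrorD n t)) := rfl
  rw [hsplit, Matrix.mulVec_sub, Pi.sub_apply, cycleOp_mulVec_cycleGreen_sub (2 * n + 2) hx, cycleOp_mulVec_cycleGreen_sub (2 * n + 2) hx,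
    Pi.single_eq_of_ne (dblD_ne_mirrorD n s t), sub_zero]
  by_cases hst : s = t
  · subst hst; rw [Pi.single_eq_same, Pi.single_eq_same]
  · rw [Pi.single_eq_of_ne hst, Pi.single_eq_of_ne (fun h => hst (dblD_injective n h))]

/-- ★★ `A·G = 1` for the Dirichlet operator and the odd image-sum matrix. [cite: King1986, §4 p.670] -/
theorem pathOpD_mul_greenMatrix {x : ℝ} (hx : 0 < x) :
    pathOpD n x * (Matrix.of fun s t => pathGreenD n x s t) = 1 := by
  ext s t
  have h := congr_fun (pathOpD_mulVec_pathGreenD n hx t) s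
  rw [Matrix.mulVec, dotProduct] at h
  rw [Matrix.mul_apply, Matrix.one_apply, ← Pi.single_apply t (1 : ℝ) s, ← h]
  rfl

/-- The Dirichlet operator is invertible (`x > 0`). [folklore] -/
theorem isUnit_pathOpD {x : ℝ} (hx : 0 < x) : IsUnit (pathOpD n x) :=
  IsUnit.of_mul_eq_one _ (pathOpD_mul_greenMatrix n hx)

/-- ★★★ **THE METHOD OF IMAGES, odd (Dirichlet ends)**: `((2+x) − S − S⁻¹)_D⁻¹(s,t) = G^{torus}_{2n+2}(s − t) − G^{torus}_{2n+2}(s + t + 2)`,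
every `n ≥ 1`, `x > 0`. [cite: King1986, §4 p.670] -/
theorem pathOpD_inv_apply {x : ℝ} (hx : 0 < x) (s t : Fin n) : (pathOpD n x)⁻¹ s t = pathGreenD n x s t := by
  rw [Matrix.inv_eq_right_inv (pathOpD_mul_greenMatrix n hx), Matrix.of_apply]

/-- The Dirichlet Green's function is symmetric. [folklore] -/
theorem pathGreenD_symm (x : ℝ) (s t : Fin n) : pathGreenD n x t s = pathGreenD n x s t := by
  unfold pathGreenD
  rw [show dblD n t - dblD n s = -(dblD n s - dblD n t) by ring, cycleGreen_neg,
    show dblD n t - mirrorD n s = dblD n s - mirrorD n t by simp only [dblD, mirrorD]; ring]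

end Images

/-! ## §5 The closed forms -/

section ClosedForm

/-- ★★ **CLOSED FORM (difference)**: `G^D(s,t) = (cosh(ω(n+1 − |s−t|)) − cosh(ω(n − 1 − s − t))) ∕ (2 sinh ω · sinh(ω(n+1)))`.
[cite: King1986, §4 p.670; MontvayMunster1994, §2.2.1 (2.74)–(2.76)] -/
theorem pathGreenD_eq_cosh_sub (x : ℝ) (s t : Fin n) :
    pathGreenD n x s t
      = (Real.cosh (latticeMass x * (n + 1 - ((max s.val t.val : ℕ) - (min s.val t.val : ℕ) : ℝ)))
          - Real.cosh (latticeMass x * (n - 1 - s.val - t.val)))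
        / (2 * Real.sinh (latticeMass x) * Real.sinh (latticeMass x * (n + 1))) := by
  have hper : latticeMass x * ((2 * n + 2 : ℕ) : ℝ) / 2 = latticeMass x * (n + 1) := by push_cast; ring
  have hhalf : (((2 * n + 2 : ℕ) : ℝ)) / 2 = n + 1 := by push_cast; ring
  have h2 : cycleGreen (2 * n + 2) x (dblD n s - mirrorD n t)
      = Real.cosh (latticeMass x * (n - 1 - s.val - t.val)) / (2 * Real.sinh (latticeMass x) * Real.sinh (latticeMass x * (n + 1))) := by
    unfold cycleGreen cycleProfile
    rw [val_dblD_sub_mirrorD, hper, hhalf, ← Real.cosh_neg]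
    congr 2; push_cast; ring
  have h1 : cycleGreen (2 * n + 2) x (dblD n s - dblD n t)
      = Real.cosh (latticeMass x * (n + 1 - ((max s.val t.val : ℕ) - (min s.val t.val : ℕ) : ℝ)))
          / (2 * Real.sinh (latticeMass x) * Real.sinh (latticeMass x * (n + 1))) := by
    rcases le_total t.val s.val with hts | hst
    · unfold cycleGreen cycleProfile
      rw [val_dblD_sub_dblD n hts, hper, hhalf, max_eq_left hts, min_eq_right hts, Nat.cast_sub hts, ← Real.cosh_neg]
      congr 2; ring
    · rw [show dblD n s - dblD n t = -(dblD n t - dblD n s) by ring, cycleGreen_neg]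
      unfold cycleGreen cycleProfile
      rw [val_dblD_sub_dblD n hst, hper, hhalf, max_eq_right hst, min_eq_left hst, Nat.cast_sub hst, ← Real.cosh_neg]
      congr 2; ring
  unfold pathGreenD
  rw [h1, h2, ← sub_div]

/-- ★★ **CLOSED FORM (product)**: `G^D(s,t) = sinh(ω(min(s,t)+1))·sinh(ω(n − max(s,t))) ∕ (sinh ω · sinh(ω(n+1)))` — the textbook Dirichlet Green's
function of the massive chain. [cite: King1986, §4 p.670; MontvayMunster1994, §2.2.1 (2.74)–(2.76)] -/
theorem pathGreenD_eq_sinh_mul_sinh (x : ℝ) (s t : Fin n) :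
    pathGreenD n x s t
      = Real.sinh (latticeMass x * ((min s.val t.val : ℕ) + 1)) * Real.sinh (latticeMass x * (n - (max s.val t.val : ℕ)))
        / (Real.sinh (latticeMass x) * Real.sinh (latticeMass x * (n + 1))) := by
  rw [pathGreenD_eq_cosh_sub]
  have hsum : (min s.val t.val : ℕ) + (max s.val t.val : ℕ) = s.val + t.val := min_add_max _ _
  have hst : ((s.val : ℝ) + t.val) = ((min s.val t.val : ℕ) : ℝ) + ((max s.val t.val : ℕ) : ℝ) := by exact_mod_cast hsum.symm
  set ω := latticeMass x
  set lo : ℝ := ((min s.val t.val : ℕ) : ℝ)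
  set hi : ℝ := ((max s.val t.val : ℕ) : ℝ)
  -- `sinh A sinh B = (cosh(A+B) − cosh(A−B))∕2`
  have hprod : Real.sinh (ω * (lo + 1)) * Real.sinh (ω * (n - hi))
      = (Real.cosh (ω * (n + 1 - (hi - lo))) - Real.cosh (ω * (n - 1 - s.val - t.val))) / 2 := by
    have e1 : ω * (n + 1 - (hi - lo)) = ω * (lo + 1) + ω * (n - hi) := by ring
    have e2 : ω * (n - 1 - s.val - t.val) = -(ω * (lo + 1) - ω * (n - hi)) := by
      have : (n : ℝ) - 1 - s.val - t.val = n - 1 - lo - hi := by linarith [hst]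
      rw [this]; ring
    rw [e1, e2, Real.cosh_neg, Real.cosh_add, Real.cosh_sub]; ring
  rw [hprod]
  field_simp

/-- ★ The Dirichlet Green's function is STRICTLY POSITIVE on the box (`x > 0`): `sinh(ω(min+1)) > 0`, `sinh(ω(n−max)) > 0`. [folklore] -/
theorem pathGreenD_pos {x : ℝ} (hx : 0 < x) (s t : Fin n) : 0 < pathGreenD n x s t := by
  rw [pathGreenD_eq_sinh_mul_sinh]
  have hω := latticeMass_pos hx
  have h1 : 0 < Real.sinh (latticeMass x * ((min s.val t.val : ℕ) + 1)) := Real.sinh_pos_iff.mpr (by positivity)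
  have h2 : 0 < Real.sinh (latticeMass x * (n - (max s.val t.val : ℕ))) := by
    apply Real.sinh_pos_iff.mpr
    have : ((max s.val t.val : ℕ) : ℝ) < n := by
      have := max_lt s.isLt t.isLt
      exact_mod_cast this
    nlinarith
  have h3 : 0 < Real.sinh (latticeMass x) := Real.sinh_pos_iff.mpr hω
  have h4 : 0 < Real.sinh (latticeMass x * (n + 1)) := Real.sinh_pos_iff.mpr (by positivity)
  positivity

end ClosedForm

end Summit.QuantumFields.YangMills.BalabanUVNodes.N15KingModelRung.TorusSpectral
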